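import Summits.Ventures.PercRepro.MSTightExtSideColumn
import Summits.Ventures.PercRepro.MSTightLocalDichotomyOfTightExt

/-!
# Theorem (i) TightExt holds, and the local dichotomy in its genuine form follows

Dossier proofs/MINE1-theoremS.md, Addendum 54 supplement 4. The candidate Prop `TightExt α`
(Theorem (i) of Addendum 52 supplement 1: for a tight twin-free `P` without minimum or maximum
member, a covering excess-one `K ⊆ P` and a member `m ∈ P ∖ K` eligible on both sides, one of the
two eligible sides of `P ∖ K` is contained in `{m}`) is a theorem (`tightExt`): the main case
`extension_side_of_cover_of_Rstar'` applies when `K` has a member inside and a member containing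
the addable part of `insert m K`, the row exception `extension_side_of_row` when no member
contains it, the column exception `extension_side_of_column` when no member lies inside it.

With `localDichotomyGenuine_of_tightExt` this makes **`LocalDichotomyGenuine α` a theorem**
(`localDichotomyGenuine`) — the open shape of Conjecture (T) (Addendum 54).
-/

namespace PercRepro.MSTight

open Finset
open scoped FinsetFamily

variable (α : Type*) [DecidableEq α] [Fintype α]

/-- **Theorem (i) TightExt.** -/
theorem tightExt : TightExt α := by
  intro P K m hP htf hmin hmax hKP hK hcov hmP hmK hm1 hm0
  have hne : K.Nonempty := by
    rw [nonempty_iff_ne_empty]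
    rintro rfl
    simp at hK
  have hT : Tight (insert m K) := tight_insert_of_sdiff_subset hK hmK hm1 hm0
  by_cases hk₁ : ∃ k₁ ∈ K, Rstar (insert m K) ⊆ k₁
  · by_cases hk₀ : ∃ k₀ ∈ K, k₀ ⊆ Rstar (insert m K)
    · exact extension_side_of_cover_of_Rstar' hP hT hmP hKP hne
        (fun a b ha ha' hab => eq_of_twin_of_cover htf hcov hab ha ha') hm1 hm0 hcov hk₀ hk₁
    · push Not at hk₀
      exact Or.inr (extension_side_of_column hP htf hmin hmax hKP hne hT hmP hm1 hm0 hcov hk₀)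
  · push Not at hk₁
    exact Or.inl (extension_side_of_row hP htf hmin hmax hne hT hmP hm1 hm0 hcov hk₁)

/-- **The local dichotomy in its genuine form holds** — the open shape of Conjecture (T). -/
theorem localDichotomyGenuine : LocalDichotomyGenuine α :=
  localDichotomyGenuine_of_tightExt (tightExt α)

end PercRepro.MSTight
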